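import Mathlib
import HarnessLib
import HarnessLib.Audit
import Summits.Parity.Statement
import Literature.NumberTheory.Sieve.CircleMethod

/-!
Route: VinogradovForTwins

CLOSED (retired) 2026-08-15T13:50:50Z by operator:999:1257524 — reason: not-a-thesis: assembly does not conclude the sub-problem Statement — note: D-0027 §2.1 audit (human 2026-08-15: routes that do not decide the summit are removed): the assembly concludes `SchurTriplesOfTwins`, not the sub-problem statement; a NEW conforming route may be opened from the same idea (generated `closes : … → _root_.GeneralizedHardyLittlewood`).. The file is kept as the record of this route; refuted decls are indexed as negative knowledge (`ledger negatives`).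

# Route VinogradovForTwins — Vinogradov for twin primes — minor-arc uniformity of the twin measure,
necessary for GHL and (with twins in APs) sufficient for its Schur-triple instance

X = TwinsInProgressions ∧ TwinMinorArcUniformity ("it suffices to show X" for the target
SchurTriplesOfTwins). Target: the
d = 2, t = 6 infinite-complexity instance of Green–Tao's Conjecture 1.2 for the corner system Ψ =
(n₁, n₁+2, n₂, n₂+2, n₁+n₂,
n₁+n₂+2) — "x, y, x+y all lower twins" with the GHL asymptotic over every convex K ⊆ [−N,N]² — a
verbatim special case of
the sub-problem statement. TwinsInProgressions (major arcs): the Λ-weighted Hardy–Littlewood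
asymptotic for the pair
(qm+b, qm+b+2) for every FIXED modulus q and class b, over intervals (d = 1, t = 2 instances of GHL;
implied by the sibling
conjunct BatemanHorn). TwinMinorArcUniformity (V, "Vinogradov for twin primes"): ∀ε ∃Q ∀N ≥ N₀: sup
over the minor arcs
𝔪_Q(N) of |Σ_{n≤N} Λ(n)Λ(n+2)e(nα)| ≤ εN. V is main-term-free and is a NECESSARY consequence of GHL
(support item
MinorArcUniformityOfGHL); the assembly is the circle method with the Green–Tao 2006 restriction
estimate for the twin
majorant (support TwinRestrictionEstimate). Realises card vinogradov-for-twins (spine) with the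
scope correction of its
addenda nil-uniformity-hierarchy / gowers-tower-cluster-calculus (linear-phase uniformity pays
exactly the collapsed-complexity-1
cluster configurations, of which the corner system is the model).
Lean: `(∀ (q : ℕ) (b : ℤ), 1 ≤ q → ∀ ε : ℝ, 0 < ε → ∃ N₀ : ℕ, ∀ N : ℕ, N₀ ≤ N → ∀ K : Set (Fin 1 →
ℝ), Convex ℝ K → K ⊆ Literature.NumberTheory.Sieve.realBox 1 N →
|Literature.NumberTheory.Sieve.vonMangoldtSum (![⟨![(q : ℤ)], b⟩, ⟨![(q : ℤ)], b + 2⟩] : Fin 2 →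
Literature.NumberTheory.Sieve.AffLinForm 1) K N - Literature.NumberTheory.Sieve.archFactor (![⟨![(q
: ℤ)], b⟩, ⟨![(q : ℤ)], b + 2⟩] : Fin 2 → Literature.NumberTheory.Sieve.AffLinForm 1) K *
Literature.NumberTheory.Sieve.singularProduct (![⟨![(q : ℤ)], b⟩, ⟨![(q : ℤ)], b + 2⟩] : Fin 2 →
Literature.NumberTheory.Sieve.AffLinForm 1)| ≤ ε * (N : ℝ)) ∧ (∀ ε : ℝ, 0 < ε → ∃ Q : ℝ, 0 < Q ∧ ∃
N₀ : ℕ, ∀ N : ℕ, N₀ ≤ N → ∀ α : ℝ, α ∈ Literature.NumberTheory.Sieve.minorArcs N Q Q → ‖∑ n ∈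
Finset.Icc 1 N, ((ArithmeticFunction.vonMangoldt n * ArithmeticFunction.vonMangoldt (n + 2) : ℝ) :
ℂ) * (Real.fourierChar ((n : ℝ) * α) : ℂ)‖ ≤ ε * (N : ℝ))`

## Assembly
Circle method for a ternary problem in the twin measure, PROVABLE but sizable (comparable to
DicksonFibration's assembly). Fix ε;
only lattice points with n₁, n₂ ≥ 1 contribute (Λ vanishes on ℤ_{≤0}). Decompose K ⊆ [−N,N]² into
cells of side ηN: boundary cells
(O(1/η) of them, K convex) contribute ≪ ηN² by the crude enveloping-sieve upper bound for the
six-form system on a convex body (tree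
Literature/NumberTheory/Sieve/LinearEquationsInPrimesCrudeBounds, GreenTao2010 App. D); an interior
cell I×J contributes
Σ_{x∈I,y∈J} T(x)T(y)T(x+y) = ∫₀¹ T̂_I(α)T̂_J(α)conj(T̂_{[1,2N]}(α))dα. Major arcs 𝔐 (q ≤ Q, |β| ≤
Q/2N): TwinsInProgressions for
the finitely many (q,b), q ≤ Q, on initial intervals plus partial summation with the bounded factor
1 + 2π|β|·2N ≤ 1 + 2πQ gives
T̂_I(a/q+β) = c_T(a,q) Σ_{x∈I} e(βx) + o_Q(N) with c_T(a,q) = Σ_b e(ab/q)·(density of Ψ_{q,b}); the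
main terms sum to
𝔖^{(Q)} · #{(x,y) ∈ I×J} with 𝔖^{(Q)} → Σ_q Σ_{(a,q)=1} c_T(a,q)² conj(c_T(a,q)) = ∏_p β_p(Ψ) =
singularProduct Ψ (local Parseval on
ℤ/p for the collapsed system (x, y, x+y), multiplicativity over squarefree q, tree
tendsto_singularProductPartial for the tail),
and Σ_cells |I||J| = archFactor Ψ K + O(ηN²). Minor arcs: |∫_𝔪 T̂_I T̂_J conj T̂| ≤ sup_𝔪|T̂|^θ ·
‖T̂_I‖₃ ‖T̂_J‖₃ ‖T̂‖_{3(1−θ)}^{1−θ}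
≤ (ε'·2N)^θ · C N^{2/3} N^{2/3} N^{2/3−θ} = O(ε'^θ N²) by TwinMinorArcUniformity at scale 2N (with Q
enlarged to cover both uses;
minorArcs shrinks as Q grows) and TwinRestrictionEstimate at p = 3 and p = 3(1−θ) ∈ (2,3). Let N →
∞, then Q → ∞, then η → 0.

Rationale: WHY THIS LINE. Every route of this sub-problem attacks the d = 1 binary count; none isolates what
Green–Tao's conjecture (GreenTao2010, Conj. 1.2,
Lemma 1.6) contains BEYOND d = 1 once shifts are bounded: for a system whose parallel-form clusters
ℓ_c + {0,2} sit on a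
complexity-1 configuration (x, y, x+y), the count is a ternary circle-method problem in the twin
measure T(n) = Λ(n)Λ(n+2), whose
major arcs are twins in progressions and whose minor arcs are exactly V. V is the additive analogue
of Vinogradov's estimate
(tree: Literature.NumberTheory.Sieve.vinogradov_primeExpSumLog_bound), has no main term, no singular
series and no Selberg ghost,
and — new here — is provably NECESSARY for the summit (the additive-energy system (a, a+2, b, b+2,
c, c+2, a+b−c, a+b−c+2) is a
GHL instance whose main term the major arcs exhaust, so ∫_𝔪 |T̂|⁴ = o(N³) and a derivative bound
gives sup_𝔪 |T̂| = o(N)),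
so a refutation of V refutes the conjunct. Imported: the Hardy–Littlewood–Vinogradov circle method
(VaughanHL1997,
Nathanson1996 Thm 8.5), restriction theory for the enveloping sieve (GreenTao2006Restriction Thm 1.1
/ Prop 4.2, all p > 2),
almost-twin precedents for the minor arcs (MatomakiShao2017; BienvenuShaoTeravainen2023 transference
with cluster weights) and,
as the proposed engine habitat, Fourier uniformity of multiplicative functions
(MatomakiRadziwillTao2020Fourier). No spectral,
probabilistic or motivic reformulation is used: the point of the line is that the additive (Fourier)
axis of the twin measure
is a stand-alone, parity-free theorem target that no prior route or negative touches.

RANKED CRUXES. #0 SchurTriplesOfTwins (target) — GHL for the corner system Ψ = (n₁, n₁+2, n₂, n₂+2,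
n₁+n₂, n₁+n₂+2) on ℤ²: for every ε > 0, eventually in N, for every convex K ⊆ [−N,N]², |Σ_{n ∈ K∩ℤ²}
∏ᵢ Λ(ψᵢ(n)) − β_∞ ∏_p β_p| ≤ εN² (Schur triples x, y, x+y of lower twin primes with the Green–Tao
weight; the d = 2, t = 6, L = 14 instance of the sub-problem statement). (why it might fail:
Contains twins in progressions (parity-hard) as its major arcs; today only LOWER bounds for such
patterns in Chen / bounded-gap almost-twins exist (GreenTao2006Restriction Thm 1.2,
BienvenuShaoTeravainen2023, Pintz 2010).) [GreenTao2010, GreenTao2006Restriction,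
BienvenuShaoTeravainen2023, doi:10.1007/978-3-642-14444-8_15]
#2 TwinMinorArcUniformity (crux) — (V, card vinogradov-for-twins) Fourier uniformity of the twin
measure on minor arcs: for every ε > 0 there are Q > 0 and N₀ such that for all N ≥ N₀ and all α ∈ 𝔪
= [0,1] ∖ ⋃_{q ≤ Q, (a,q)=1} {|α − a/q| ≤ Q/N}, |Σ_{n ≤ N} Λ(n)Λ(n+2) e(nα)| ≤ εN. Main-term-free;
Siegel-insensitive; implied by GHL (item MinorArcUniformityOfGHL), so ¬V refutes the conjunct.
[difficulty: open-problem] (why it might fail: No engine: opening both Λ leaves twisted 2-point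
Möbius sums on lines (moduli to x^(1−δ)); MRT uniformity is 1-point/interval-averaged; and at α =
a/q with q → ∞ slowly, V encodes non-concentration of twins mod q, which sieve bounds + positivity
cannot give.) [MatomakiShao2017, MatomakiRadziwillTao2020Fourier, GreenTao2006Restriction,
GreenTao2010, doi:10.1007/s10474-010-0015-9]
#3 TwinVinogradovInequality (crux) — Vinogradov's inequality for the twin measure (the quantitative,
log-lossy form of V on the deep minor arcs, modelled on tree
Literature.NumberTheory.Sieve.vinogradov_primeExpSumLog_bound): there are B, C and c > 0 with
|Σ_{n≤N} Λ(n)Λ(n+2)e(nα)| ≤ C N (log N)^B (q^{−c} + N^{−c} + (q/N)^c) whenever 1 ≤ q ≤ N, (a,q) = 1,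
|α − a/q| ≤ q^{−2}. Its natural proof is the card's double opening: geometric-series / bilinear
ranges plus the TWISTED DETERMINANT CORE Σ μ(m)μ(u)e(αmk) on uv − mk = 2 (linear phase αkv·t along
each line), the layer-2 content of this crux. [deps: TwinMinorArcUniformity] [difficulty:
open-problem] (why it might fail: Asserts a power saving: false if N^(1−o(1)) twins cluster in a
Bohr set (no sieve bound excludes it); its proof needs 2-point Möbius cancellation on dilated
progressions with a linear twist and (log x)^(−A) family savings — no such theorem; Matomäki–Shao
get it only for sieve-weighted almost-twins.) [Nathanson1996, Vinogradov1937, MatomakiShao2017,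
MatomakiRadziwillTao2020Fourier, doi:10.4007/annals.2023.197.2.3]
#4 TwinsInProgressions (crux) — Twins in progressions to FIXED moduli (major-arc data; DimOne_bdd):
for every q ≥ 1, b ∈ ℤ and ε > 0, eventually in N, for every interval K ⊆ [−N,N], |Σ_{m ∈ K∩ℤ}
Λ(qm+b)Λ(qm+b+2) − β_∞ ∏_p β_p(Ψ_{q,b})| ≤ εN for the pair system Ψ_{q,b} = (qm+b, qm+b+2) — the d =
1, t = 2, L = 2q+|b|+|b+2| instances of GHL (q = 1: the twin prime asymptotic); follows from
DicksonFibration.PairsDimOne (stmt-Parity-0821) and from BatemanHorn (support item). [difficulty: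
open-problem] (why it might fail: Contains the twin prime asymptotic (q = 1): open; sieves at any
level are blocked by parity (SelbergParityBarrier, PrimePairParity) and the circle method by
minor-arc L² mass (CircleMethodBinaryBarrier); shared binary core, not specific to this line.)
[HardyLittlewood1923, GreenTao2010, BatemanHorn1962,
Literature.Barriers.Parity.SelbergParityBarrier, Literature.Barriers.Parity.PrimePairParity,
Literature.Barriers.Parity.CircleMethodBinaryBarrier]
#9 TwinRestrictionEstimate (support) — L^p restriction bound for twin-weighted exponential sums,
every p > 2: ∫₀¹ |Σ_{n≤N} f(n)Λ(n)Λ(n+2)e(nα)|^p dα ≤ C_p N^{p−1} for all |f| ≤ 1 (from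
GreenTao2006Restriction Prop 4.2 for the enveloping sieve β_R of F(n) = n(n+2), R = N^{1/20}: T ≤
C(log N/log R)² β_R on twins, prime powers trivially). Supplies the log-free minor-arc Hölder step
(exponents 3, 3, 3(1−θ)) of the assembly. [difficulty: provable-now] [GreenTao2006Restriction,
arXiv:math/0405581]
#9 MinorArcUniformityOfGHL (support) — V is NECESSARY for the sub-problem:
GeneralizedHardyLittlewood → TwinMinorArcUniformity. Proof plan: the additive-energy system (a, a+2,
b, b+2, c, c+2, a+b−c, a+b−c+2) (d = 3, t = 8, bounded size, K = {0 ≤ a+b−c ≤ N} convex) is a GHL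
instance with Σ = ∫₀¹|T̂|⁴; the major arcs (twins in progressions = d = 1 instances of GHL, q ≤ Q,
|β| ≤ Q/N) exhaust its main term as Q → ∞ (Σ_q Σ_a |c_T(a,q)|⁴ = ∏_p β_p by local Parseval); hence
∫_𝔪 |T̂|⁴ ≤ (o(1) + tail_Q)N³, and |T̂'| ≤ 2πN Σ_{n≤N} T(n) ≪ N² (PairsHL from GHL, or tree
TwinSieveUpperBound) turns a value |T̂(α₀)| ≥ εN at α₀ ∈ 𝔪 into ∫ ≫ ε⁵N³ — contradiction.
[difficulty: L] [GreenTao2010, VaughanHL1997, Literature.NumberTheory.Sieve.TwinSieveUpperBound]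
#9 TwinsInProgressionsOfBatemanHorn (support) — The sibling conjunct pays the major arcs:
BatemanHorn → TwinsInProgressions (f₁ = qX+b, f₂ = qX+b+2 are a Bateman–Horn system when the class
is admissible — count ~ C(f) x/log²x, converted to the Λ-weighted interval form by partial
summation, prime powers negligible; inadmissible classes are trivial with singularProduct = 0).
Records that inside Parity = BatemanHorn ∧ GHL the target needs only V beyond BH. [difficulty:
provable-now] [BatemanHorn1962, GreenTao2010]

TWO-LAYER PLAN. Foreseen glued splits (none filed now). V ⇐ TwinVinogradovInequality →
MidArcNonConcentration → V, where MidArcNonConcentration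
controls α = a/q + β with q ≤ (log N)^B, |β| ≤ (log N)^B/N outside 𝔐_Q (twins mod slowly growing q
with power-of-q decay of
|c_T(a,q)|, or a Siegel–Walfisz-type twins-in-APs statement) and the glue is Dirichlet bookkeeping
(second-approximation trick for the
zones just outside 𝔐_Q). TwinVinogradovInequality ⇐ SmoothRanges (Λ = Λ♯ + Λ♭ à la GreenTao2010 §12
for BOTH factors: Λ♯Λ♯ by sieve
Fourier computation, cross terms by Bombieri–Vinogradov with an additive twist at level N^γ, e.g.
Matomäki JNT 2009 / Mikawa 2000)
→ TwistedDeterminantCore (card Crux 1: ℓ¹ over lines (k,v) of |Σ_t μ(m₀+tv)μ(u₀+tk)e(αkvt)| with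
(log x)^{−A} saving off the
resonant lines) → TwinVinogradovInequality. Assembly ⇐ MajorArcIdentity (𝔖 = ∏_p β_p) →
CellDecomposition → Assembly if a prover
asks. The general anatomy theorem of the addenda (every collapsed-complexity-1 cluster
configuration, every bounded tuple H) is a
later support statement, not a crux.

KILL CRITERIA. ¬TwinMinorArcUniformity (a fixed ε and, for every Q, minor-arc peaks ≥ εN at
infinitely many N) closes the route
`refuted:TwinMinorArcUniformity` AND, via MinorArcUniformityOfGHL, refutes the conjunct
GeneralizedHardyLittlewood itself — hand the
witness to the summit. ¬TwinVinogradovInequality alone (e.g. incompatibility of a power saving with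
a proved irregularity result)
forces a pivot: restate rank 3 as the rate-free deep-minor-arc bound (sup over 𝔪_{(log N)^B} =
o(N)); the route survives on V.
¬TwinsInProgressions refutes GHL (and BatemanHorn). A refuter showing V ⟹ a positive lower bound for
Σ_{n≤N}Λ(n)Λ(n+2) (i.e. that
V is not parity-free) does not kill the route but demotes its rationale; a proof that
TwinRestrictionEstimate fails for some p ∈
(2,3) (it cannot, by GreenTao2006Restriction Prop 4.2, unless mis-typed) sends the assembly back for
re-typing. If DicksonFibration's
PairsDimOne (stmt-Parity-0821) is proved, TwinsInProgressions closes and the route reduces to V; if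
GHL is proved by any route, this
one is moot except as the necessity lemma.

NOT DECOMPOSED YET. The twisted determinant core is NOT filed as an item: its coefficient classes
depend on the exact Λ♯/Λ♭ (or Heath-Brown) split and
on how the resonant lines (‖αkv‖ small) are excised — it is the layer-2 child of
TwinVinogradovInequality once a prover fixes the
decomposition. Also deliberately left: the singular-series identity Σ_qΣ_a c_T(a,q)²c̄_T(a,q) = ∏_p
β_p(Ψ) and the cell/boundary
bookkeeping (helper lemmas of the Assembly, `--supports Assembly`); the general-H / general
complexity-1 anatomy theorem and the
singleton-elimination theorem of gowers-tower-cluster-calculus (support statements later); the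
corrected Bohr/sparsity ghost of the
card (triage F2: a barrier lemma, not load-bearing); the s ≥ 2 nil-uniformity tower of
nil-uniformity-hierarchy (a different thesis).

CHEAPEST FALSIFIER. (1) A refuter checks in Lean that the corner system is a GHL instance
(IsNondegenerateSystem, affLinSize ≤ 14 for N ≥ 1) and that
TwinsInProgressions is an instance of DicksonFibration.PairsDimOne — if either fails the target/crux
is mis-typed (I checked the
arithmetic by hand: sizes 8 + 6/N and 2q + (|b|+|b+2|)/N; a(n₁) = b(n₁+2) ∀n forces a = b = 0). (2)
kit numerics, one job: for
x = 10⁷…10⁸ compute max over a grid of 10⁴ minor-arc α (Q = 50) of |Σ_{p,p+2 ≤ x} log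
p·log(p+2)·e(αp)|/x and the L³, L⁴ moments of the
same sum / x², x³ — square-root-size sup and bounded moments support V and TwinRestrictionEstimate;
a sup ≍ x at a badly approximable
α would be alarming (not a refutation). (3) Literature lookup: if Matomäki–Shao (MatomakiShao2017
§§6–8) or Tolev already bound the
GENUINE Λ(n)Λ(n+2) minor arcs conditionally on twins-in-APs, rank 3's novelty drops to
known-conditional (the route survives).

NUMBERS. Vinogradov for primes (tree, Nathanson1996 Thm 8.5): |Σ_{p≤N} log p e(pα)| ≤ 1552 (N
q^{−1/2} + N^{4/5} + N^{1/2}q^{1/2})(log N)⁴ —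
the rank-3 crux asks for ANY exponent c > 0 and any log power B for the twin measure.
GreenTao2006Restriction Prop 4.2: all p > 2,
sieve level R ≪ N^{1/10}. Sieve mass bound available in tree: Σ_{n≤N}Λ(n)Λ(n+2) ≤ (C+o(1))𝔖N with C
= 4 (Selberg/Bombieri–Davenport),
3.5 (BFI), 3.399 (Wu) (Literature.NumberTheory.Sieve.TwinSieveUpperBound and twinSieve_*).
Almost-twin minor arcs known for P₂/P₃
weights (MatomakiShao2017: p, p+2 with at most two prime factors in Vinogradov's theorem). Items at
open: 8 (1 target, 3 cruxes,
3 supports, 1 assembly).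

DEFINITION REQUESTS. None (all statements are one-liners over
Literature.NumberTheory.Sieve.{AffLinForm, vonMangoldtSum, archFactor, singularProduct,
realBox, minorArcs}, ArithmeticFunction.vonMangoldt and Real.fourierChar). Cite fact wanted (filed
after open): GreenTao2006Restriction
Prop 4.2 (L^p extension estimate for the enveloping sieve, p > 2) as a Literature named fact for the
prover of TwinRestrictionEstimate.

Novelty: Searches (2026-08-15): `lit search --source crossref "exponential sums over twin primes"` (12:
Buttkewitz doi:10.1007/s10474-010-0015-9,
Maier–Sankaranarayanan, Ramaré–Viswanadham 2023, Mikawa 2000 — none on genuine-twin minor arcs); `…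
"Vinogradov three primes theorem
almost twin primes"` (→ MatomakiShao2017, Shao 2014 density version); `… "Green Tao restriction
theory Selberg sieve"` (→
GreenTao2006Restriction; `lit read arXiv:math/0405581` pp. 2, 7: Thm 1.1 and Prop 4.2 confirmed for
all p > 2); `… "Bienvenu Shao
Teräväinen transference"` (→ BienvenuShaoTeravainen2023); `… "arithmetic progressions of twin primes
conditional Hardy-Littlewood
Fourier uniformity prime tuples"` (12, nothing relevant beyond Laporta 1999); `lit frontier Parity
--since 2021` (30 rows: Higher
uniformity II doi:10.1007/s00222-026-01408-6, arXiv:2605.18676, arXiv:2603.09281 — finite complexity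
/ sparse hosts only); `lit galaxy
search "exponential sums over twin primes minor arcs" --star all` (no output: service down); local
searchd down (recorded); the five
route files of the sub and all 114 cards (only the two addenda touch tuple-measure uniformity);
`ledger negatives --problem Parity` (0).
Nearest prior art found: MatomakiShao2017 (doi:10.1112/s0010437x17007072: minor arcs for
SIEVE-WEIGHTED almost twins inside Vinogradov's
theorem), GreenTao2006Restriction (doi:10.5802/jtnb.538: restriction for the twin majorant; 3-APs of
Chen primes, lower bounds),
BienvenuShaoTeravainen2023 (doi:10.2140/ant.202  [refs: 10.1007/s10474-010-0015-9, 10.1007/s00222-026-01408-6, 10.1112/s0010437x17007072:, 10.5802/jtnb.538:, 10.2140/ant.2023.17.231:, math/0405581, 2605.18676, 2603.09281, math/0606088, doi:10.1007/s10474-010-0015-9, doi:10.1007/s00222-026-01408-6, doi:10.1112/s0010437x17007072, doi:10.5802/jtnb.538, doi:10.2140/ant.2023.17.231, MatomakiShao2017, BienvenuShaoTeravainen2023, GreenTao2010]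

Barriers (technique_class: fourier-uniformity-tuple-measures, circle-method): - technique_class: fourier-uniformity-tuple-measures, circle-method
- Literature.Barriers.Parity.CircleMethodBinaryBarrier: respected, not met — no binary count is
derived from size bounds on an exponential sum; V is a size bound on the TWIN-weighted sum used only
for a TERNARY problem in the twin measure, with the binary counts (TwinsInProgressions) imported as
a hypothesis.
- Literature.Barriers.Parity.RedactedPrimes: same — the 'tight' major-arc information is a
hypothesis (twins in APs), never manufactured from loose L^∞ data; redacting twins changes
TwinsInProgressions, which the assembly consumes explicitly.
- Literature.Barriers.Parity.TrueComplexityBinary: respected and organising — no Gowers/Fourier norm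
is applied across the parallel pair (n, n+2); uniformity is applied only across the collapsed system
(x, y, x+y) of true complexity 1, exactly where U² control is a theorem.
- Literature.Barriers.Parity.CriticalDensityHalf: not met — no dense-model/transference step forces
twins from density; the majorant enters only through the restriction estimate (an upper bound).
- Literature.Barriers.Parity.SelbergParityBarrier: it does not evade it for TwinsInProgressions
(rank 4 carries the full parity content, conceded); V and TwinVinogradovInequality are
main-term-free statements about phases, to which the Selberg/Bombieri ghost construction
(reweighting by 1 ± λ(n)λ(n+2)) does not apply — the bet is that the additive axis is attackable by
bilinear/pretentious methods where

History (route lifecycle, newest last):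
- 2026-08-15T13:50:50Z · CLOSED retired — not-a-thesis: assembly does not conclude the sub-problem Statement (operator:999:1257524)

sub-problem: GeneralizedHardyLittlewood · status: closed(retired) · opened planner-plancard-Parity-GeneralizedHardyLittl-ab396bfa-0 2026-08-15T11:44:33Z · rev 1 · ledger route-Parity-VinogradovForTwins
GENERATED by the gate from the ledger (D-0016/17). Provers cite these decls: `theorem foo : Summit.Parity.GeneralizedHardyLittlewood.Theses.VinogradovForTwins.<Decl> := …` in Summits/Parity/GeneralizedHardyLittlewood/Theorems/<Name>.lean.
-/

namespace Summit.Parity.GeneralizedHardyLittlewood.Theses.VinogradovForTwins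

open scoped BigOperators Topology Manifold Classical MeasureTheory ProbabilityTheory Matrix InnerProductSpace ComplexConjugate ContinuousMap
open Filter Set Function TopologicalSpace MeasureTheory

attribute [summit_statement] _root_.GeneralizedHardyLittlewood

/-- item stmt-Parity-6110 · target · rank 0 · closed · moot by None · by planner
why it might fail: Contains twins in progressions (parity-hard) as its major arcs; today only LOWER bounds for such patterns in Chen / bounded-gap almost-twins exist (GreenTao2006Restriction Thm 1.2, BienvenuShaoTeravainen2023, Pintz 2010).
sources: GreenTao2010, GreenTao2006Restriction, BienvenuShaoTeravainen2023, doi:10.1007/978-3-642-14444-8_15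
[target] GHL for the corner system Ψ = (n₁, n₁+2, n₂, n₂+2, n₁+n₂, n₁+n₂+2) on ℤ²: for every ε > 0,
eventually in N, for every convex K ⊆ [−N,N]², |Σ_{n ∈ K∩ℤ²} ∏ᵢ Λ(ψᵢ(n)) − β_∞ ∏_p β_p| ≤ εN² (Schur
triples x, y, x+y of lower twin primes with the Green–Tao weight; the d = 2, t = 6, L = 14 instance
of the sub-problem statement). -/
@[route_item "route-Parity-VinogradovForTwins"]
def SchurTriplesOfTwins : Prop :=
  ∀ ε : ℝ, 0 < ε → ∃ N₀ : ℕ, ∀ N : ℕ, N₀ ≤ N → ∀ K : Set (Fin 2 → ℝ), Convex ℝ K → K ⊆ Literature.NumberTheory.Sieve.realBox 2 N → |Literature.NumberTheory.Sieve.vonMangoldtSum (![⟨![1, 0], 0⟩, ⟨![1, 0], 2⟩, ⟨![0, 1], 0⟩, ⟨![0, 1], 2⟩, ⟨![1, 1], 0⟩, ⟨![1, 1], 2⟩] : Fin 6 → Literature.NumberTheory.Sieve.AffLinForm 2) K N - Literature.NumberTheory.Sieve.archFactor (![⟨![1, 0], 0⟩, ⟨![1, 0], 2⟩, ⟨![0,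 1], 0⟩, ⟨![0, 1], 2⟩, ⟨![1, 1], 0⟩, ⟨![1, 1], 2⟩] : Fin 6 → Literature.NumberTheory.Sieve.AffLinForm 2) K * Literature.NumberTheory.Sieve.singularProduct (![⟨![1, 0], 0⟩, ⟨![1, 0], 2⟩, ⟨![0, 1], 0⟩, ⟨![0, 1], 2⟩, ⟨![1, 1], 0⟩, ⟨![1, 1], 2⟩] : Fin 6 → Literature.NumberTheory.Sieve.AffLinForm 2)| ≤ ε * (N : ℝ) ^ 2

/-- item stmt-Parity-6111 · crux · rank 2 · closed · moot by None · by planner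
why it might fail: No engine: opening both Λ leaves twisted 2-point Möbius sums on lines (moduli to x^(1−δ)); MRT uniformity is 1-point/interval-averaged; and at α = a/q with q → ∞ slowly, V encodes non-concentration of twins mod q, which sieve bounds + positivity cannot give.
sources: MatomakiShao2017, MatomakiRadziwillTao2020Fourier, GreenTao2006Restriction, GreenTao2010, doi:10.1007/s10474-010-0015-9
[crux] (V, card vinogradov-for-twins) Fourier uniformity of the twin measure on minor arcs: for
every ε > 0 there are Q > 0 and N₀ such that for all N ≥ N₀ and all α ∈ 𝔪 = [0,1] ∖ ⋃_{q ≤ Q,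
(a,q)=1} {|α − a/q| ≤ Q/N}, |Σ_{n ≤ N} Λ(n)Λ(n+2) e(nα)| ≤ εN. Main-term-free; Siegel-insensitive;
implied by GHL (item MinorArcUniformityOfGHL), so ¬V refutes the conjunct. [difficulty:
open-problem] -/
@[route_item "route-Parity-VinogradovForTwins"]
def TwinMinorArcUniformity : Prop :=
  ∀ ε : ℝ, 0 < ε → ∃ Q : ℝ, 0 < Q ∧ ∃ N₀ : ℕ, ∀ N : ℕ, N₀ ≤ N → ∀ α : ℝ, α ∈ Literature.NumberTheory.Sieve.minorArcs N Q Q → ‖∑ n ∈ Finset.Icc 1 N, ((ArithmeticFunction.vonMangoldt n * ArithmeticFunction.vonMangoldt (n + 2) : ℝ) : ℂ) * (Real.fourierChar ((n : ℝ) * α) : ℂ)‖ ≤ ε * (N : ℝ)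

/-- item stmt-Parity-6112 · crux · rank 3 · closed · moot by None · by planner
why it might fail: Asserts a power saving: false if N^(1−o(1)) twins cluster in a Bohr set (no sieve bound excludes it); its proof needs 2-point Möbius cancellation on dilated progressions with a linear twist and (log x)^(−A) family savings — no such theorem; Matomäki–Shao get it only for sieve-weighted almost-twins.
sources: Nathanson1996, Vinogradov1937, MatomakiShao2017, MatomakiRadziwillTao2020Fourier, doi:10.4007/annals.2023.197.2.3
[crux] Vinogradov's inequality for the twin measure (the quantitative, log-lossy form of V on the
deep minor arcs, modelled on tree Literature.NumberTheory.Sieve.vinogradov_primeExpSumLog_bound):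
there are B, C and c > 0 with |Σ_{n≤N} Λ(n)Λ(n+2)e(nα)| ≤ C N (log N)^B (q^{−c} + N^{−c} + (q/N)^c)
whenever 1 ≤ q ≤ N, (a,q) = 1, |α − a/q| ≤ q^{−2}. Its natural proof is the card's double opening:
geometric-series / bilinear ranges plus the TWISTED DETERMINANT CORE Σ μ(m)μ(u)e(αmk) on uv − mk = 2
(linear phase αkv·t along each line), the layer-2 content of this crux. [deps:
TwinMinorArcUniformity] [difficulty: open-problem] -/
@[route_item "route-Parity-VinogradovForTwins"]
def TwinVinogradovInequality : Prop :=
  ∃ (B : ℕ) (C c : ℝ), 0 < c ∧ ∀ N : ℕ, 2 ≤ N → ∀ (α : ℝ) (a : ℤ) (q : ℕ), 1 ≤ q → q ≤ N → IsCoprime a (q : ℤ) → |α - a / q| ≤ 1 / (q : ℝ) ^ 2 → ‖∑ n ∈ Finset.Icc 1 N, ((ArithmeticFunction.vonMangoldt n * ArithmeticFunction.vonMangoldt (n + 2) : ℝ) : ℂ) * (Real.fourierChar ((n : ℝ) * α) : ℂ)‖ ≤ C * (N : ℝ) * Real.log N ^ B * ((q : ℝ) ^ (-c) + (N : ℝ)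 ^ (-c) + ((q : ℝ) / N) ^ c)

/-- item stmt-Parity-6113 · crux · rank 4 · closed · moot by None · by planner
why it might fail: Contains the twin prime asymptotic (q = 1): open; sieves at any level are blocked by parity (SelbergParityBarrier, PrimePairParity) and the circle method by minor-arc L² mass (CircleMethodBinaryBarrier); shared binary core, not specific to this line.
sources: HardyLittlewood1923, GreenTao2010, BatemanHorn1962, Literature.Barriers.Parity.SelbergParityBarrier, Literature.Barriers.Parity.PrimePairParity, Literature.Barriers.Parity.CircleMethodBinaryBarrier
[crux] Twins in progressions to FIXED moduli (major-arc data; DimOne_bdd): for every q ≥ 1, b ∈ ℤ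
and ε > 0, eventually in N, for every interval K ⊆ [−N,N], |Σ_{m ∈ K∩ℤ} Λ(qm+b)Λ(qm+b+2) − β_∞ ∏_p
β_p(Ψ_{q,b})| ≤ εN for the pair system Ψ_{q,b} = (qm+b, qm+b+2) — the d = 1, t = 2, L = 2q+|b|+|b+2|
instances of GHL (q = 1: the twin prime asymptotic); follows from DicksonFibration.PairsDimOne
(stmt-Parity-0821) and from BatemanHorn (support item). [difficulty: open-problem] -/
@[route_item "route-Parity-VinogradovForTwins"]
def TwinsInProgressions : Prop :=
  ∀ (q : ℕ) (b : ℤ), 1 ≤ q → ∀ ε : ℝ, 0 < ε → ∃ N₀ : ℕ, ∀ N : ℕ, N₀ ≤ N → ∀ K : Set (Fin 1 → ℝ), Convex ℝ K → K ⊆ Literature.NumberTheory.Sieve.realBox 1 N → |Literature.NumberTheory.Sieve.vonMangoldtSum (![⟨![(q : ℤ)], b⟩, ⟨![(q : ℤ)], b + 2⟩] : Fin 2 → Literature.NumberTheory.Sieve.AffLinForm 1) K N - Literature.NumberTheory.Sieve.archFactor (![⟨![(q : ℤ)], b⟩, ⟨![(q : ℤ)], b + 2⟩] : Fin 2 → Literature.NumberTheory.Sieve.AffLinForm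 1) K * Literature.NumberTheory.Sieve.singularProduct (![⟨![(q : ℤ)], b⟩, ⟨![(q : ℤ)], b + 2⟩] : Fin 2 → Literature.NumberTheory.Sieve.AffLinForm 1)| ≤ ε * (N : ℝ)

/-- item stmt-Parity-6114 · support · rank 9 · closed · moot by None · by planner
sources: GreenTao2006Restriction, arXiv:math/0405581
[support] L^p restriction bound for twin-weighted exponential sums, every p > 2: ∫₀¹ |Σ_{n≤N}
f(n)Λ(n)Λ(n+2)e(nα)|^p dα ≤ C_p N^{p−1} for all |f| ≤ 1 (from GreenTao2006Restriction Prop 4.2 for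
the enveloping sieve β_R of F(n) = n(n+2), R = N^{1/20}: T ≤ C(log N/log R)² β_R on twins, prime
powers trivially). Supplies the log-free minor-arc Hölder step (exponents 3, 3, 3(1−θ)) of the
assembly. [difficulty: provable-now] -/
@[route_item "route-Parity-VinogradovForTwins"]
def TwinRestrictionEstimate : Prop :=
  ∀ p : ℝ, 2 < p → ∃ C : ℝ, ∀ N : ℕ, ∀ f : ℕ → ℂ, (∀ n, ‖f n‖ ≤ 1) → ∫ α in (0 : ℝ)..1, ‖∑ n ∈ Finset.Icc 1 N, f n * ((ArithmeticFunction.vonMangoldt n * ArithmeticFunction.vonMangoldt (n + 2) : ℝ) : ℂ) * (Real.fourierChar ((n : ℝ) * α) : ℂ)‖ ^ p ≤ C * (N : ℝ) ^ (p - 1)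

/-- item stmt-Parity-6115 · support · rank 9 · closed · moot by None · by planner
sources: GreenTao2010, VaughanHL1997, Literature.NumberTheory.Sieve.TwinSieveUpperBound
[support] V is NECESSARY for the sub-problem: GeneralizedHardyLittlewood → TwinMinorArcUniformity.
Proof plan: the additive-energy system (a, a+2, b, b+2, c, c+2, a+b−c, a+b−c+2) (d = 3, t = 8,
bounded size, K = {0 ≤ a+b−c ≤ N} convex) is a GHL instance with Σ = ∫₀¹|T̂|⁴; the major arcs (twins
in progressions = d = 1 instances of GHL, q ≤ Q, |β| ≤ Q/N) exhaust its main term as Q → ∞ (Σ_q Σ_a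
|c_T(a,q)|⁴ = ∏_p β_p by local Parseval); hence ∫_𝔪 |T̂|⁴ ≤ (o(1) + tail_Q)N³, and |T̂'| ≤ 2πN
Σ_{n≤N} T(n) ≪ N² (PairsHL from GHL, or tree TwinSieveUpperBound) turns a value |T̂(α₀)| ≥ εN at α₀
∈ 𝔪 into ∫ ≫ ε⁵N³ — contradiction. [difficulty: L] -/
@[route_item "route-Parity-VinogradovForTwins"]
def MinorArcUniformityOfGHL : Prop :=
  GeneralizedHardyLittlewood → TwinMinorArcUniformity

/-- item stmt-Parity-6116 · support · rank 9 · closed · moot by None · by planner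
sources: BatemanHorn1962, GreenTao2010
[support] The sibling conjunct pays the major arcs: BatemanHorn → TwinsInProgressions (f₁ = qX+b, f₂
= qX+b+2 are a Bateman–Horn system when the class is admissible — count ~ C(f) x/log²x, converted to
the Λ-weighted interval form by partial summation, prime powers negligible; inadmissible classes are
trivial with singularProduct = 0). Records that inside Parity = BatemanHorn ∧ GHL the target needs
only V beyond BH. [difficulty: provable-now] -/
@[route_item "route-Parity-VinogradovForTwins"]
def TwinsInProgressionsOfBatemanHorn : Prop :=
  BatemanHorn → TwinsInProgressions

/-- item stmt-Parity-6117 · assembly · rank 1 · closed · moot by None · by planner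
sources: VaughanHL1997, GreenTao2006Restriction, GreenTao2010
[assembly] TwinsInProgressions → TwinMinorArcUniformity → TwinRestrictionEstimate →
SchurTriplesOfTwins (major arcs, minor arcs, restriction input ⟹ the corner instance of GHL). -/
@[route_item "route-Parity-VinogradovForTwins"]
def Assembly : Prop :=
  TwinsInProgressions → TwinMinorArcUniformity → TwinRestrictionEstimate → SchurTriplesOfTwins

end Summit.Parity.GeneralizedHardyLittlewood.Theses.VinogradovForTwins
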